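import Literature.AlgebraicGeometry.Motives.HodgeLieWeilClassesProduct
import Literature.AlgebraicGeometry.Motives.HodgeThetaAnnihilatorSemisimpleTimesAbelian
import HarnessLib

/-!
# `𝔥(H₁ ⊕ H₂) ⊊ 𝔥(H₁) × 𝔥(H₂)` under a Weil-type action of a quadratic field — summand `H₂` of ANY rank
# (Moonen–Zarhin 1999 Thm. 0.1 (4)(a) beyond the elliptic-curve summand: `H₂ = H¹` of any abelian variety with `E ↪ End⁰`)

Family `hodge`, layer `Literature/AlgebraicGeometry/Motives`; THEOREMS ONLY (no definition, no named fact).  Written for the cell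
`pub-hodgecm2` (COR-CM), seat `b27` gen 48 (count-neutral Mumford–Tate-rank ladder).  Sequel of `Motives/HodgeLieWeilClassesProduct`,
which treats `dim_ℚ V₂ = 2` (the summand `H¹` of a CM elliptic curve); here `V₂` is arbitrary (`dim_ℚ V₂ ≥ 2`).

SETTING.  `H ≅ H₁ ⊕ H₂` (morphisms `ι_i`, `π_i`, `π_i ι_i = id`, `ι₁π₁ + ι₂π₂ = id`), a quadratic number field `E` acting compatibly
(`A₁`, `A₂`, `A : EndAction`, `A.ι e ∘ ι_i = ι_i ∘ A_i.ι e`), `e₀ ∈ E`, the CORNER operator `X = ι₂ A₂(e₀) π₂` («`e₀` on `H₂`, `0` on `H₁`»).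

RESULTS.
* §1 **`finrank_hodgeLie_lt_add_of_corner_not_mem`** (any weight, no field): if `Y ∈ 𝔥(H₂)` but the corner `ι₂ Y π₂ ∉ 𝔥(H)`, then
  `dim 𝔥(H) < dim 𝔥(H₁) + dim 𝔥(H₂)` — the block map `X ↦ (π₁Xι₁, π₂Xι₂)`, `𝔥(H) ↪ 𝔥(H₁) × 𝔥(H₂)` (`eq_sum_blocks_of_mem_hodgeLie`,
  `comp_mem_hodgeLie_of_retract`), is injective and misses `(0, Y)`.
* §2 **`weilLine_le_eigenspace_derivation_corner'`** — the Weil line `⋀ᵈ V_{ℂ,σ}` (`d = dim V_{ℂ,σ}`) lies in the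
  `(d₂ · σ(e₀))`-eigenspace of `D_{X_ℂ}`, `d₂ = dim V_{2,ℂ,σ} = dim_ℚ V₂ / 2`: `V_{ℂ,σ} = ι₂ V_{2,ℂ,σ} ⊕ ι₁ V_{1,ℂ,σ}` has an
  `X_ℂ`-eigenbasis with eigenvalue `σ e₀` on the first block and `0` on the second.
* §3 (weight one, effective) **`corner_not_mem_and_finrank_hodgeLie_lt_of_weilType_of_two_le`** — total action of Weil type
  (`2(n_σ(H₁) + n_σ(H₂)) = dim_ℚ V / 2`), `e₀ ≠ 0`, `dim_ℚ V₂ ≥ 2` ⟹ `ι₂ A₂(e₀) π₂ ∉ 𝔥(H)` (its derivation scales the Weil lines by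
  `d₂ σ(e₀) ≠ 0`, while `𝔥(H)` kills the Weil classes — `not_mem_hodgeLie_of_weilType_of_derivation_eigenvalues`), AND, if moreover
  `A₂(e₀) ∈ 𝔥(H₂)`, then `dim 𝔥(H) < dim 𝔥(H₁) + dim 𝔥(H₂)` (one bundled statement; the tree's `…_of_weilType` pair is `dim_ℚ V₂ = 2`).
AV reading (`CorCM`): two simple abelian threefolds `T`, `T'` of type IV with ISOMORPHIC imaginary quadratic endomorphism fields:
choosing the identification of the fields so that the signatures are `(2,1)` and `(1,2)`, the diagonal action on `H¹(T × T')` is of Weil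
type, so `dim MT(H¹(T × T')) ≤ 18 < 19 = t(T) + t(T') − 1`: `Hg(T × T') ≠ Hg(T) × Hg(T')`.

## References
* [MoonenZarhin1999LowDim] B. Moonen, Yu. G. Zarhin, Math. Ann. 315 (1999), Thm. 0.1 (4)(a), §3 (3.1), Prop. (3.8)
  [corpus: paper:arxiv-math_9901113 pp. 1–2, 6–7]. [cite: MoonenZarhin1999LowDim, Thm. 0.1 (4) and §3 (3.1)]
* [Deligne1982HodgeCycles] P. Deligne, LNM 900 (1982), I §3.1, Prop. 3.4; §4 Prop. 4.4 (Weil classes). [cite: Deligne1982HodgeCycles, §4 Prop. 4.4]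
-/

noncomputable section

open scoped TensorProduct

namespace Literature.AlgebraicGeometry.Motives

namespace HodgeStructure

universe u

variable {V₁ : Type u} [AddCommGroup V₁] [Module ℚ V₁] [Module.Finite ℚ V₁]
  {V₂ : Type u} [AddCommGroup V₂] [Module ℚ V₂] [Module.Finite ℚ V₂]
  {V : Type u} [AddCommGroup V] [Module ℚ V] [Module.Finite ℚ V] [HodgeTensorFacts.{u, u}]

section General

variable {n : ℤ} {H₁ : HodgeStructure V₁ n} {H₂ : HodgeStructure V₂ n} {H : HodgeStructure V n}
  (ι₁ : Hom H₁ H) (π₁ : Hom H H₁) (ι₂ : Hom H₂ H) (π₂ : Hom H H₂)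
  (hπι₁ : ∀ v, π₁.toLinearMap (ι₁.toLinearMap v) = v) (hπι₂ : ∀ v, π₂.toLinearMap (ι₂.toLinearMap v) = v)
  (hsum : ∀ v, ι₁.toLinearMap (π₁.toLinearMap v) + ι₂.toLinearMap (π₂.toLinearMap v) = v)

omit [Module.Finite ℚ V₁] [Module.Finite ℚ V₂] [Module.Finite ℚ V] [HodgeTensorFacts.{u, u}] in
include hπι₁ hπι₂ hsum in
/-- `π₂ ι₁ = 0`. [folklore] -/
private theorem proj₂_incl₁_eq_zero_wc (v : V₁) : π₂.toLinearMap (ι₁.toLinearMap v) = 0 := by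
  have h := congrArg π₂.toLinearMap (hsum (ι₁.toLinearMap v))
  rw [map_add, hπι₁ v, hπι₂] at h
  exact add_eq_left.1 h

omit [Module.Finite ℚ V₁] [Module.Finite ℚ V₂] [Module.Finite ℚ V] [HodgeTensorFacts.{u, u}] in
include hπι₁ hπι₂ hsum in
/-- `π₁ ι₂ = 0`. [folklore] -/
private theorem proj₁_incl₂_eq_zero_wc (v : V₂) : π₁.toLinearMap (ι₂.toLinearMap v) = 0 := by
  have h := congrArg π₁.toLinearMap (hsum (ι₂.toLinearMap v))
  rw [map_add, hπι₂ v, hπι₁] at h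
  exact add_eq_left.1 h

/-! ## §1 A corner of `𝔥(H₂)` missing from `𝔥(H)` makes the block map non-surjective -/

include hπι₁ hπι₂ hsum in
/-- **`dim 𝔥(H₁ ⊕ H₂) < dim 𝔥(H₁) + dim 𝔥(H₂)` as soon as some `Y ∈ 𝔥(H₂)` has its corner `ι₂ Y π₂ ∉ 𝔥(H)`** (any weight).  The block map
`X ↦ (π₁Xι₁, π₂Xι₂)`, `𝔥(H) → 𝔥(H₁) × 𝔥(H₂)` (`comp_mem_hodgeLie_of_retract`), is injective (`eq_sum_blocks_of_mem_hodgeLie`); were the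
dimensions equal it would be onto and the preimage of `(0, Y)` would be `ι₂ Y π₂ ∈ 𝔥(H)`.  (Moonen–Zarhin §3 (3.1): `Hg(X₁ × X₂) ⊆
Hg(X₁) × Hg(X₂)` with surjective projections; strictness is witnessed by an element of `Lie Hg(X₂)` not liftable with zero first block.)
[cite: MoonenZarhin1999LowDim, §3 (3.1)] [cite: Deligne1982HodgeCycles, I §3.1 and Prop. 3.4] -/
theorem finrank_hodgeLie_lt_add_of_corner_not_mem {Y : Module.End ℚ V₂} (hY : Y ∈ H₂.hodgeLie)
    (hcorner : ι₂.toLinearMap ∘ₗ Y ∘ₗ π₂.toLinearMap ∉ H.hodgeLie) :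
    Module.finrank ℚ H.hodgeLie < Module.finrank ℚ H₁.hodgeLie + Module.finrank ℚ H₂.hodgeLie := by
  let r₁ : Module.End ℚ V →ₗ[ℚ] Module.End ℚ V₁ :=
    (LinearMap.llcomp ℚ V₁ V V₁ π₁.toLinearMap).comp (LinearMap.lcomp ℚ V ι₁.toLinearMap)
  let r₂ : Module.End ℚ V →ₗ[ℚ] Module.End ℚ V₂ :=
    (LinearMap.llcomp ℚ V₂ V V₂ π₂.toLinearMap).comp (LinearMap.lcomp ℚ V ι₂.toLinearMap)
  have hr₁ : ∀ X, r₁ X = π₁.toLinearMap ∘ₗ X ∘ₗ ι₁.toLinearMap := fun X => rfl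
  have hr₂ : ∀ X, r₂ X = π₂.toLinearMap ∘ₗ X ∘ₗ ι₂.toLinearMap := fun X => rfl
  let B : H.hodgeLie →ₗ[ℚ] (H₁.hodgeLie × H₂.hodgeLie) :=
    LinearMap.prod
      (LinearMap.codRestrict H₁.hodgeLie (r₁.comp H.hodgeLie.subtype) fun X => by
        rw [LinearMap.comp_apply, Submodule.subtype_apply, hr₁]; exact comp_mem_hodgeLie_of_retract ι₁ π₁ hπι₁ X.2)
      (LinearMap.codRestrict H₂.hodgeLie (r₂.comp H.hodgeLie.subtype) fun X => by
        rw [LinearMap.comp_apply, Submodule.subtype_apply, hr₂]; exact comp_mem_hodgeLie_of_retract ι₂ π₂ hπι₂ X.2)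
  have hB1 : ∀ X : H.hodgeLie, ((B X).1 : Module.End ℚ V₁) = π₁.toLinearMap ∘ₗ (X : Module.End ℚ V) ∘ₗ ι₁.toLinearMap := fun X => rfl
  have hB2 : ∀ X : H.hodgeLie, ((B X).2 : Module.End ℚ V₂) = π₂.toLinearMap ∘ₗ (X : Module.End ℚ V) ∘ₗ ι₂.toLinearMap := fun X => rfl
  have hBinj : Function.Injective B := by
    intro X X' hXX'
    apply Subtype.ext
    have h1 : π₁.toLinearMap ∘ₗ (X : Module.End ℚ V) ∘ₗ ι₁.toLinearMap = π₁.toLinearMap ∘ₗ (X' : Module.End ℚ V) ∘ₗ ι₁.toLinearMap := by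
      rw [← hB1, ← hB1, hXX']
    have h2 : π₂.toLinearMap ∘ₗ (X : Module.End ℚ V) ∘ₗ ι₂.toLinearMap = π₂.toLinearMap ∘ₗ (X' : Module.End ℚ V) ∘ₗ ι₂.toLinearMap := by
      rw [← hB2, ← hB2, hXX']
    rw [eq_sum_blocks_of_mem_hodgeLie ι₁ π₁ ι₂ π₂ hπι₁ hπι₂ hsum X.2, eq_sum_blocks_of_mem_hodgeLie ι₁ π₁ ι₂ π₂ hπι₁ hπι₂ hsum X'.2,
      h1, h2]
  have hle : Module.finrank ℚ H.hodgeLie ≤ Module.finrank ℚ H₁.hodgeLie + Module.finrank ℚ H₂.hodgeLie := by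
    rw [← Module.finrank_prod]
    exact LinearMap.finrank_le_finrank_of_injective hBinj
  refine lt_of_le_of_ne hle fun heq => ?_
  have hBsurj : Function.Surjective B := by
    have hdim : Module.finrank ℚ H.hodgeLie = Module.finrank ℚ (H₁.hodgeLie × H₂.hodgeLie) := by rw [Module.finrank_prod, heq]
    exact (LinearMap.injective_iff_surjective_of_finrank_eq_finrank hdim).1 hBinj
  obtain ⟨Z, hZ⟩ := hBsurj (0, ⟨Y, hY⟩)
  have hZ1 : π₁.toLinearMap ∘ₗ (Z : Module.End ℚ V) ∘ₗ ι₁.toLinearMap = 0 := by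
    rw [← hB1, hZ]; rfl
  have hZ2 : π₂.toLinearMap ∘ₗ (Z : Module.End ℚ V) ∘ₗ ι₂.toLinearMap = Y := by
    rw [← hB2, hZ]
  have hZeq : (Z : Module.End ℚ V) = ι₂.toLinearMap ∘ₗ Y ∘ₗ π₂.toLinearMap := by
    rw [eq_sum_blocks_of_mem_hodgeLie ι₁ π₁ ι₂ π₂ hπι₁ hπι₂ hsum Z.2, hZ1, hZ2, LinearMap.zero_comp, LinearMap.comp_zero, zero_add]
  exact hcorner (hZeq ▸ Z.2)

/-! ## §2 The corner operator scales the Weil line `⋀ᵈ V_{ℂ,σ}` by `d₂ · σ(e₀)`, `d₂ = dim V_{2,ℂ,σ}` -/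

variable {E : Type*} [Field E] [NumberField E] (A₁ : EndAction H₁ E) (A₂ : EndAction H₂ E) (A : EndAction H E)
  (hA₁ : ∀ e, A.ι e ∘ₗ ι₁.toLinearMap = ι₁.toLinearMap ∘ₗ A₁.ι e) (hA₂ : ∀ e, A.ι e ∘ₗ ι₂.toLinearMap = ι₂.toLinearMap ∘ₗ A₂.ι e)

omit [HodgeTensorFacts.{u, u}] in
include hπι₁ hπι₂ hsum hA₁ hA₂ in
/-- **The Weil line of the corner operator, summand of any rank.**  For `X = ι₂ A₂(e₀) π₂` and `[E:ℚ] = 2`: the line `⋀ᵈ V_{ℂ,σ}`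
(`d = dim V_{ℂ,σ}`) lies in the `(d₂ · σ(e₀))`-eigenspace of `D_{X_ℂ}`, `d₂ = dim_ℚ V₂ / 2 = dim V_{2,ℂ,σ}` — `V_{ℂ,σ} = ι₂ V_{2,ℂ,σ} ⊕
ι₁ V_{1,ℂ,σ}` has a basis of `X_ℂ`-eigenvectors with eigenvalues `σ e₀` (`d₂` times) and `0`.
[cite: MoonenZarhin1999LowDim, Thm. 0.1 (4) and §3 (3.1)] [cite: Deligne1982HodgeCycles, §4 Prop. 4.4] -/
theorem weilLine_le_eigenspace_derivation_corner' (hE2 : Module.finrank ℚ E = 2) (e₀ : E) (σ : E →+* ℂ) {d : ℕ}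
    (hd : Module.finrank ℂ ↥(⨅ e, Module.End.eigenspace ((A.ι e).baseChange ℂ) (σ e)) = d) :
    LinearMap.range (exteriorPower.map d (⨅ e, Module.End.eigenspace ((A.ι e).baseChange ℂ) (σ e)).subtype) ≤
      Module.End.eigenspace (derivationExteriorPower ((ι₂.toLinearMap ∘ₗ A₂.ι e₀ ∘ₗ π₂.toLinearMap).baseChange ℂ) d)
        (((Module.finrank ℚ V₂ / 2 : ℕ) : ℂ) * σ e₀) := by
  classical
  set N₁ := (⨅ e, Module.End.eigenspace ((A₁.ι e).baseChange ℂ) (σ e)) with hN₁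
  set N₂ := (⨅ e, Module.End.eigenspace ((A₂.ι e).baseChange ℂ) (σ e)) with hN₂
  set N := (⨅ e, Module.End.eigenspace ((A.ι e).baseChange ℂ) (σ e)) with hN
  have h2 : Module.finrank ℂ N₂ = Module.finrank ℚ V₂ / 2 := by rw [hN₂, A₂.finrank_iInf_eigenspace_of_finrank_eq_two hE2 σ]
  have hadd := finrank_iInf_eigenspace_sum ι₁ π₁ ι₂ π₂ hπι₁ hπι₂ hsum A₁ A₂ A hA₁ hA₂ σ
  rw [← hN, ← hN₁, ← hN₂, hd] at hadd
  set d₁ := Module.finrank ℂ N₁ with hd₁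
  set d₂ := Module.finrank ℂ N₂ with hd₂
  rw [← h2]
  let b₁ : Module.Basis (Fin d₁) ℂ N₁ := Module.finBasisOfFinrankEq ℂ N₁ rfl
  let b₂ : Module.Basis (Fin d₂) ℂ N₂ := Module.finBasisOfFinrankEq ℂ N₂ rfl
  -- the family `v = (ι₂ b₂, ι₁ b₁)` indexed by `Fin (d₂ + d₁)`
  have hdd : d₂ + d₁ = d := by omega
  subst hdd
  let u : Fin d₂ → ℂ ⊗[ℚ] V := fun i => ι₂.toLinearMap.baseChange ℂ (b₂ i : ℂ ⊗[ℚ] V₂)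
  let w : Fin d₁ → ℂ ⊗[ℚ] V := fun j => ι₁.toLinearMap.baseChange ℂ (b₁ j : ℂ ⊗[ℚ] V₁)
  let v : Fin (d₂ + d₁) → ℂ ⊗[ℚ] V := Fin.append u w
  let c : Fin (d₂ + d₁) → ℂ := Fin.append (fun _ : Fin d₂ => σ e₀) (fun _ : Fin d₁ => (0 : ℂ))
  have hπι₁' : π₁.toLinearMap ∘ₗ ι₁.toLinearMap = LinearMap.id := LinearMap.ext hπι₁
  have hπι₂' : π₂.toLinearMap ∘ₗ ι₂.toLinearMap = LinearMap.id := LinearMap.ext hπι₂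
  have hπ₁ι₂ : π₁.toLinearMap ∘ₗ ι₂.toLinearMap = 0 := LinearMap.ext (proj₁_incl₂_eq_zero_wc ι₁ π₁ ι₂ π₂ hπι₁ hπι₂ hsum)
  have hπ₂ι₁ : π₂.toLinearMap ∘ₗ ι₁.toLinearMap = 0 := LinearMap.ext (proj₂_incl₁_eq_zero_wc ι₁ π₁ ι₂ π₂ hπι₁ hπι₂ hsum)
  have hιπ : ι₁.toLinearMap ∘ₗ π₁.toLinearMap + ι₂.toLinearMap ∘ₗ π₂.toLinearMap = LinearMap.id := LinearMap.ext hsum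
  have e11 : ∀ y, π₁.toLinearMap.baseChange ℂ (ι₁.toLinearMap.baseChange ℂ y) = y := proj_incl_baseChange hπι₁'
  have e22 : ∀ y, π₂.toLinearMap.baseChange ℂ (ι₂.toLinearMap.baseChange ℂ y) = y := proj_incl_baseChange hπι₂'
  have e12 : ∀ y, π₁.toLinearMap.baseChange ℂ (ι₂.toLinearMap.baseChange ℂ y) = 0 := proj_incl_baseChange_eq_zero hπ₁ι₂
  have e21 : ∀ y, π₂.toLinearMap.baseChange ℂ (ι₁.toLinearMap.baseChange ℂ y) = 0 := proj_incl_baseChange_eq_zero hπ₂ι₁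
  -- the family lies in `N`
  have huN : ∀ i, u i ∈ N := fun i => by
    change ι₂.toLinearMap.baseChange ℂ (b₂ i : ℂ ⊗[ℚ] V₂) ∈ N
    rw [hN, mem_iInf_eigenspace_sum_iff ι₁ π₁ ι₂ π₂ hπι₁ hπι₂ hsum A₁ A₂ A hA₁ hA₂ σ, e12, e22]
    exact ⟨Submodule.zero_mem _, (b₂ i).2⟩
  have hwN : ∀ j, w j ∈ N := fun j => by
    change ι₁.toLinearMap.baseChange ℂ (b₁ j : ℂ ⊗[ℚ] V₁) ∈ N
    rw [hN, mem_iInf_eigenspace_sum_iff ι₁ π₁ ι₂ π₂ hπι₁ hπι₂ hsum A₁ A₂ A hA₁ hA₂ σ, e11, e21]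
    exact ⟨(b₁ j).2, Submodule.zero_mem _⟩
  have hvN : ∀ i, v i ∈ N := by
    intro i
    induction i using Fin.addCases with
    | left i => change Fin.append u w (Fin.castAdd d₁ i) ∈ N; rw [Fin.append_left]; exact huN i
    | right j => change Fin.append u w (Fin.natAdd d₂ j) ∈ N; rw [Fin.append_right]; exact hwN j
  -- linear independence: both blocks are injective images of bases, with disjoint spans (`π₁`, `π₂` separate them)
  have hli_u : LinearIndependent ℂ u :=
    (b₂.linearIndependent.map' N₂.subtype (Submodule.ker_subtype N₂)).map' (ι₂.toLinearMap.baseChange ℂ)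
      (LinearMap.ker_eq_bot.2 (Function.LeftInverse.injective e22))
  have hli_w : LinearIndependent ℂ w :=
    (b₁.linearIndependent.map' N₁.subtype (Submodule.ker_subtype N₁)).map' (ι₁.toLinearMap.baseChange ℂ)
      (LinearMap.ker_eq_bot.2 (Function.LeftInverse.injective e11))
  have hdisj : Disjoint (Submodule.span ℂ (Set.range u)) (Submodule.span ℂ (Set.range w)) := by
    rw [Submodule.disjoint_def]
    intro x hxu hxw
    have hu_le : Submodule.span ℂ (Set.range u) ≤ LinearMap.ker (π₁.toLinearMap.baseChange ℂ) := by
      rw [Submodule.span_le]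
      rintro _ ⟨i, rfl⟩
      rw [SetLike.mem_coe, LinearMap.mem_ker]
      exact e12 _
    have hw_le : Submodule.span ℂ (Set.range w) ≤ LinearMap.ker (π₂.toLinearMap.baseChange ℂ) := by
      rw [Submodule.span_le]
      rintro _ ⟨j, rfl⟩
      rw [SetLike.mem_coe, LinearMap.mem_ker]
      exact e21 _
    have h1 : π₁.toLinearMap.baseChange ℂ x = 0 := hu_le hxu
    have h2 : π₂.toLinearMap.baseChange ℂ x = 0 := hw_le hxw
    rw [← incl_proj_add_baseChange hιπ x, h1, h2, map_zero, map_zero, add_zero]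
  have hli : LinearIndependent ℂ v := by
    have hsumli : LinearIndependent ℂ (Sum.elim u w) := hli_u.sum_type hli_w hdisj
    have hcomp : v ∘ finSumFinEquiv = Sum.elim u w := by
      funext x
      rcases x with i | j
      · change Fin.append u w (finSumFinEquiv (Sum.inl i)) = u i
        rw [finSumFinEquiv_apply_left, Fin.append_left]
      · change Fin.append u w (finSumFinEquiv (Sum.inr j)) = w j
        rw [finSumFinEquiv_apply_right, Fin.append_right]
    exact (linearIndependent_equiv' finSumFinEquiv.symm (f := Sum.elim u w) (g := v)
      (by rw [← hcomp, Function.comp_assoc, Equiv.self_comp_symm, Function.comp_id])).2 hsumli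
  -- eigenvalues of `X_ℂ` on the family
  set X := ι₂.toLinearMap ∘ₗ A₂.ι e₀ ∘ₗ π₂.toLinearMap with hX
  have hXu : ∀ i, X.baseChange ℂ (u i) = σ e₀ • u i := fun i => by
    change X.baseChange ℂ (ι₂.toLinearMap.baseChange ℂ (b₂ i : ℂ ⊗[ℚ] V₂)) = σ e₀ • ι₂.toLinearMap.baseChange ℂ (b₂ i : ℂ ⊗[ℚ] V₂)
    have hb : (A₂.ι e₀).baseChange ℂ (b₂ i : ℂ ⊗[ℚ] V₂) = σ e₀ • (b₂ i : ℂ ⊗[ℚ] V₂) :=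
      Module.End.mem_eigenspace_iff.1 ((Submodule.mem_iInf _).1 (b₂ i).2 e₀)
    rw [hX, LinearMap.baseChange_comp, LinearMap.baseChange_comp, LinearMap.comp_apply, LinearMap.comp_apply, e22, hb, map_smul]
  have hXw : ∀ j, X.baseChange ℂ (w j) = (0 : ℂ) • w j := fun j => by
    change X.baseChange ℂ (ι₁.toLinearMap.baseChange ℂ (b₁ j : ℂ ⊗[ℚ] V₁)) = (0 : ℂ) • ι₁.toLinearMap.baseChange ℂ (b₁ j : ℂ ⊗[ℚ] V₁)
    rw [hX, LinearMap.baseChange_comp, LinearMap.baseChange_comp, LinearMap.comp_apply, LinearMap.comp_apply, e21, map_zero,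
      map_zero, zero_smul]
  have hXv : ∀ i, X.baseChange ℂ (v i) = c i • v i := by
    intro i
    induction i using Fin.addCases with
    | left i =>
      change X.baseChange ℂ (Fin.append u w (Fin.castAdd d₁ i)) = Fin.append _ _ (Fin.castAdd d₁ i) • Fin.append u w (Fin.castAdd d₁ i)
      rw [Fin.append_left, Fin.append_left]; exact hXu i
    | right j =>
      change X.baseChange ℂ (Fin.append u w (Fin.natAdd d₂ j)) = Fin.append _ _ (Fin.natAdd d₂ j) • Fin.append u w (Fin.natAdd d₂ j)
      rw [Fin.append_right, Fin.append_right]; exact hXw j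
  have hsumc : ∑ i, c i = (d₂ : ℂ) * σ e₀ := by
    rw [Fin.sum_univ_add]
    simp only [c, Fin.append_left, Fin.append_right, Finset.sum_const, Finset.card_univ, Fintype.card_fin, nsmul_eq_mul,
      mul_zero, add_zero]
  rw [← hsumc]
  haveI : Module.Finite ℂ N := inferInstance
  exact range_exteriorPower_map_subtype_le_eigenspace_of_eigenbasis N hd v hli hvN _ c hXv

end General

/-! ## §3 Weil type: the corner is not in `𝔥(H)`, and `dim 𝔥(H) < dim 𝔥(H₁) + dim 𝔥(H₂)` -/

section WeightOne

variable {H₁ : HodgeStructure V₁ 1} {H₂ : HodgeStructure V₂ 1} {H : HodgeStructure V 1}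
  (ι₁ : Hom H₁ H) (π₁ : Hom H H₁) (ι₂ : Hom H₂ H) (π₂ : Hom H H₂)
  (hπι₁ : ∀ v, π₁.toLinearMap (ι₁.toLinearMap v) = v) (hπι₂ : ∀ v, π₂.toLinearMap (ι₂.toLinearMap v) = v)
  (hsum : ∀ v, ι₁.toLinearMap (π₁.toLinearMap v) + ι₂.toLinearMap (π₂.toLinearMap v) = v)
  {E : Type*} [Field E] [NumberField E] (A₁ : EndAction H₁ E) (A₂ : EndAction H₂ E) (A : EndAction H E)
  (hA₁ : ∀ e, A.ι e ∘ₗ ι₁.toLinearMap = ι₁.toLinearMap ∘ₗ A₁.ι e) (hA₂ : ∀ e, A.ι e ∘ₗ ι₂.toLinearMap = ι₂.toLinearMap ∘ₗ A₂.ι e)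
  (heff : H.IsEffective) (hE2 : Module.finrank ℚ E = 2) (hV₂ : 2 ≤ Module.finrank ℚ V₂)
  (hW : ∀ σ : E →+* ℂ, 2 * (A₁.multiplicity σ + A₂.multiplicity σ) = Module.finrank ℚ V / 2) {e₀ : E} (he₀ : e₀ ≠ 0)

include hπι₁ hπι₂ hsum hA₁ hA₂ heff hE2 hV₂ hW he₀ in
/-- **The corner of `𝔥(H₂)` is missing from `𝔥(H₁ ⊕ H₂)` under Weil type, summand of ANY rank, and then
`dim 𝔥(H₁ ⊕ H₂) < dim 𝔥(H₁) + dim 𝔥(H₂)` as soon as `A₂(e₀) ∈ 𝔥(H₂)`.**  If the total action of the quadratic field `E` on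
`H ≅ H₁ ⊕ H₂` (effective, weight one, `dim_ℚ V₂ ≥ 2`) is OF WEIL TYPE — `2(n_σ(H₁) + n_σ(H₂)) = dim_ℚ V / 2` for every `σ` — then for
every `e₀ ≠ 0`: (1) the operator `ι₂ A₂(e₀) π₂` is NOT in `𝔥(H)` — its derivation scales the Weil lines by `d₂ σ(e₀) ≠ 0`,
`d₂ = dim_ℚ V₂ / 2` (§2), while `𝔥(H)` kills the Weil classes, which are Hodge classes
(`not_mem_hodgeLie_of_weilType_of_derivation_eigenvalues`); (2) if moreover `A₂(e₀) ∈ 𝔥(H₂)` (e.g. `H₂ = H¹T'` for an abelian variety of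
Ribet type with `E = End⁰T'`, `A₂(e₀) = φ'^* ∈ 𝔲_E = 𝔥(H¹T')`), then `dim 𝔥(H) < dim 𝔥(H₁) + dim 𝔥(H₂)` (§1): «`Hg(X₁ × X₂) ≠ Hg(X₁) × Hg(X₂)`»,
the Weil classes `⋀ᵈ_E(H₁ ⊕ H₂)` being Hodge classes moved by `Hg(H₁) × Hg(H₂)`.  (The tree's `corner_not_mem_hodgeLie_of_weilType` /
`finrank_hodgeLie_lt_add_of_weilType` are the case `dim_ℚ V₂ = 2`.)
[cite: MoonenZarhin1999LowDim, Thm. 0.1 (4) and §3 (3.1)] [cite: Deligne1982HodgeCycles, §4 Prop. 4.4 and I §3 Prop. 3.4] -/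
theorem corner_not_mem_and_finrank_hodgeLie_lt_of_weilType_of_two_le :
    ι₂.toLinearMap ∘ₗ A₂.ι e₀ ∘ₗ π₂.toLinearMap ∉ H.hodgeLie ∧
      (A₂.ι e₀ ∈ H₂.hodgeLie → Module.finrank ℚ H.hodgeLie < Module.finrank ℚ H₁.hodgeLie + Module.finrank ℚ H₂.hodgeLie) := by
  have hcorner : ι₂.toLinearMap ∘ₗ A₂.ι e₀ ∘ₗ π₂.toLinearMap ∉ H.hodgeLie := by
    obtain ⟨σ₀⟩ := (inferInstance : Nonempty (E →+* ℂ))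
    set d := Module.finrank ℚ V / 2 with hddef
    have hdim : ∀ σ : E →+* ℂ, Module.finrank ℂ ↥(⨅ e, Module.End.eigenspace ((A.ι e).baseChange ℂ) (σ e)) = d :=
      fun σ => A.finrank_iInf_eigenspace_of_finrank_eq_two hE2 σ
    have h2 : ∀ σ : E →+* ℂ, Module.finrank ℂ ↥(⨅ e, Module.End.eigenspace ((A₂.ι e).baseChange ℂ) (σ e)) = Module.finrank ℚ V₂ / 2 :=
      fun σ => A₂.finrank_iInf_eigenspace_of_finrank_eq_two hE2 σ
    have hd₂ : 0 < Module.finrank ℚ V₂ / 2 := by omega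
    have hd : 0 < d := by
      have h := finrank_iInf_eigenspace_sum ι₁ π₁ ι₂ π₂ hπι₁ hπι₂ hsum A₁ A₂ A hA₁ hA₂ σ₀
      rw [hdim, h2] at h
      omega
    have hW' : ∀ σ : E →+* ℂ, 2 * A.multiplicity σ = d := fun σ => by
      rw [EndAction.multiplicity, finrank_eigenPiece_sum ι₁ π₁ ι₂ π₂ hπι₁ hπι₂ hsum A₁ A₂ A hA₁ hA₂ σ 1 0]
      exact hW σ
    refine not_mem_hodgeLie_of_weilType_of_derivation_eigenvalues A heff hE2 hd hdim hW' _
      (fun σ => ((Module.finrank ℚ V₂ / 2 : ℕ) : ℂ) * σ e₀)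
      (fun σ => mul_ne_zero (Nat.cast_ne_zero.2 hd₂.ne') ((map_ne_zero_iff σ σ.injective).2 he₀)) fun σ => ?_
    exact weilLine_le_eigenspace_derivation_corner' ι₁ π₁ ι₂ π₂ hπι₁ hπι₂ hsum A₁ A₂ A hA₁ hA₂ hE2 e₀ σ (hdim σ)
  exact ⟨hcorner, fun hmem => finrank_hodgeLie_lt_add_of_corner_not_mem ι₁ π₁ ι₂ π₂ hπι₁ hπι₂ hsum hmem hcorner⟩

end WeightOne

end HodgeStructure

end Literature.AlgebraicGeometry.Motives

end
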